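import Summits.NavierStokesRegularity.NavierStokesRegularity.Theorems.EfficiencyFloorNearSaturationNearMaximiserSeqCoreProfileUnique
import HarnessLib

/-!
# Route `EfficiencyFloor`, crux `NearSaturationNearMaximiser` (stmt-NavierStokesRegularity-25482) on the
# `ProductionEfficiencyDecay` ladder (stmt-22866): the existence/regularity split is LOSSLESS — (I') ⟹ (I'-reg)

Def-free certificate. `…SeqCoreProfileRegularity` reduced stmt-25482 to (I'-reg) («the weak-class limit profile agrees a.e. with a
smooth field with `D⁰, D¹, D² ∈ L²`»), a consequence of the earlier residue (I') of `…SeqCoreCurlLimit` («the weak-limit gradient is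
the gradient of an admissible field»). This file proves the converse implication (I') ⟹ (I'-reg), so the two residues are
EQUIVALENT and the split existence + regularity loses nothing: an admissible field with gradient `(M_j)` is itself a weak-class
profile (`(1+|x|)^{-3/2} w ∈ L²` as `w ∈ L²`; the distributional identity by integration by parts), hence equals `w₀` a.e. by
`weakProfile_unique` (`…SeqCoreProfileUnique`).

* `weakProfile_of_admissible` — an admissible `w` with `∂ⱼw = M_j` a.e. is a weak-class profile for `(M_j)`;
* `profileRegularity_of_gradientProfile` — (I') ⟹ (I'-reg).

HONEST FRAMING: neither (I') nor (I'-reg) is proved; stmt-25482, `LerayFloorGap`, `ProductionEfficiencyDecay` (stmt-22866) and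
Navier–Stokes regularity stay OPEN; no summit statement is proved. [folklore]
-/

-- the problem directory repeats the summit name (`NavierStokesRegularity/NavierStokesRegularity`)
set_option linter.dupNamespace false

noncomputable section

namespace Summit.NavierStokesRegularity.NavierStokesRegularity.Theorems

namespace NearSaturationNearMaximiser

namespace SeqCore

open Set MeasureTheory Filter Topology Function Real
open scoped InnerProductSpace ENNReal NNReal
open Literature.Analysis.FluidPDE
open Magsanop2026Enstrophy (slice_integrable)

/-! ## §1 Admissible fields are weak-class profiles -/

/-- **An admissible field with gradient `(M_j)` a.e. is a weak-class profile for `(M_j)`**: `(1+|x|)^{-3/2} w ∈ L²` (the weight is at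
most `1` and `w ∈ L²`) and `∫⟪w, ∂ⱼψ⟫ = −∫⟪M_j, ψ⟫` for `C¹` compactly supported `ψ` (integration by parts). [folklore] -/
theorem weakProfile_of_admissible {w : EuclideanSpace ℝ (Fin 3) → EuclideanSpace ℝ (Fin 3)}
    {M : Fin 3 → EuclideanSpace ℝ (Fin 3) → EuclideanSpace ℝ (Fin 3)}
    (hw : ContDiff ℝ (⊤ : ℕ∞) w ∧ VectorCalculus.IsDivFree w ∧ (∫⁻ x, ‖iteratedFDeriv ℝ 0 w x‖ₑ ^ 2 < ⊤) ∧
      (∫⁻ x, ‖iteratedFDeriv ℝ 1 w x‖ₑ ^ 2 < ⊤) ∧ (∫⁻ x, ‖iteratedFDeriv ℝ 2 w x‖ₑ ^ 2 < ⊤))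
    (hMw : ∀ j : Fin 3, (fun x => fderiv ℝ w x (EuclideanSpace.basisFun (Fin 3) ℝ j)) =ᵐ[volume] M j) :
    MemLp (fun x => ((1 : ℝ) + ‖x‖) ^ (-(3 / 2 : ℝ)) • w x) 2 volume ∧
      ∀ (j : Fin 3) (ψ : EuclideanSpace ℝ (Fin 3) → EuclideanSpace ℝ (Fin 3)), ContDiff ℝ 1 ψ → HasCompactSupport ψ →
        ∫ x, ⟪w x, fderiv ℝ ψ x (EuclideanSpace.basisFun (Fin 3) ℝ j)⟫_ℝ = -∫ x, ⟪M j x, ψ x⟫_ℝ := by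
  obtain ⟨hcd, -, h0, h1, h2⟩ := hw
  have hc1 : ContDiff ℝ 1 w := hcd.of_le (by norm_cast)
  -- `w ∈ L²`
  have h0' : ∫⁻ x, ‖w x‖ₑ ^ (2 : ℝ) < ⊤ := by
    refine lt_of_le_of_lt (le_of_eq (lintegral_congr fun x => ?_)) h0
    rw [← ofReal_norm, ← norm_iteratedFDeriv_zero (𝕜 := ℝ) (f := w), ofReal_norm, ENNReal.rpow_two]
  have hw2 : MemLp w 2 volume := by
    refine ⟨hcd.continuous.aestronglyMeasurable, ?_⟩
    rw [eLpNorm_lt_top_iff_lintegral_rpow_enorm_lt_top two_ne_zero ENNReal.ofNat_ne_top, ENNReal.toReal_ofNat]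
    exact h0'
  refine ⟨?_, fun j ψ hψ hψc => ?_⟩
  · -- the weight is at most `1`
    refine hw2.of_le_mul (c := 1) (continuous_weight.smul hcd.continuous).aestronglyMeasurable (ae_of_all _ fun x => ?_)
    rw [norm_smul, Real.norm_eq_abs, abs_of_pos (weight_pos x), one_mul]
    refine mul_le_of_le_one_left (norm_nonneg _) ?_
    exact Real.rpow_le_one_of_one_le_of_nonpos (by linarith [norm_nonneg x]) (by norm_num)
  · have IBP := integral_inner_fderiv_apply_const_eq_neg hc1 hψ hψc (EuclideanSpace.basisFun (Fin 3) ℝ j)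
    have e : (∫ x, ⟪fderiv ℝ w x (EuclideanSpace.basisFun (Fin 3) ℝ j), ψ x⟫_ℝ) = ∫ x, ⟪M j x, ψ x⟫_ℝ :=
      integral_congr_ae ((hMw j).mono fun x hx => by
        have hx' : fderiv ℝ w x (EuclideanSpace.basisFun (Fin 3) ℝ j) = M j x := hx
        show ⟪fderiv ℝ w x (EuclideanSpace.basisFun (Fin 3) ℝ j), ψ x⟫_ℝ = ⟪M j x, ψ x⟫_ℝ
        rw [hx'])
    calc (∫ x, ⟪w x, fderiv ℝ ψ x (EuclideanSpace.basisFun (Fin 3) ℝ j)⟫_ℝ)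
        = -∫ x, ⟪fderiv ℝ w x (EuclideanSpace.basisFun (Fin 3) ℝ j), ψ x⟫_ℝ := by linarith [IBP]
      _ = -∫ x, ⟪M j x, ψ x⟫_ℝ := by rw [e]

/-! ## §2 (I') ⟹ (I'-reg) -/

/-- **The split is lossless: (I') implies (I'-reg).** Given (I') — an admissible field `w` with `∂ⱼw = M_j` a.e. along every centred
normalised maximising subsequence — every weak-class profile `w₀` for `(M_j)` agrees a.e. with `w` (`weakProfile_of_admissible`,
`weakProfile_unique`), which is smooth with `D⁰, D¹, D² ∈ L²`. [folklore] -/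
theorem profileRegularity_of_gradientProfile
    (HI : ∀ c : ℝ, (0 < c ∧ (∀ v : EuclideanSpace ℝ (Fin 3) → EuclideanSpace ℝ (Fin 3), (ContDiff ℝ (⊤ : ℕ∞) v ∧
      Literature.Analysis.FluidPDE.VectorCalculus.IsDivFree v ∧ (∫⁻ x, ‖iteratedFDeriv ℝ 0 v x‖ₑ ^ 2 < ⊤) ∧
      (∫⁻ x, ‖iteratedFDeriv ℝ 1 v x‖ₑ ^ 2 < ⊤) ∧ (∫⁻ x, ‖iteratedFDeriv ℝ 2 v x‖ₑ ^ 2 < ⊤)) → (∫ x,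
      ⟪Literature.Analysis.FluidPDE.curl v x, fderiv ℝ v x (Literature.Analysis.FluidPDE.curl v x)⟫_ℝ) ≤ c *
      (∫ x, ‖Literature.Analysis.FluidPDE.curl v x‖ ^ 2) ^ (3 / 4 : ℝ) * (∫ x,
      Literature.Analysis.FluidPDE.frobeniusNormSq (fderiv ℝ (Literature.Analysis.FluidPDE.curl v) x)) ^ (3 / 4 : ℝ)) ∧ ∀ c' : ℝ, (∀ w : EuclideanSpace ℝ (Fin 3) → EuclideanSpace ℝ (Fin 3), (ContDiff ℝ (⊤ : ℕ∞) w ∧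
      Literature.Analysis.FluidPDE.VectorCalculus.IsDivFree w ∧ (∫⁻ x, ‖iteratedFDeriv ℝ 0 w x‖ₑ ^ 2 < ⊤) ∧
      (∫⁻ x, ‖iteratedFDeriv ℝ 1 w x‖ₑ ^ 2 < ⊤) ∧ (∫⁻ x, ‖iteratedFDeriv ℝ 2 w x‖ₑ ^ 2 < ⊤)) → (∫ x,
      ⟪Literature.Analysis.FluidPDE.curl w x, fderiv ℝ w x (Literature.Analysis.FluidPDE.curl w x)⟫_ℝ) ≤ c' *
      (∫ x, ‖Literature.Analysis.FluidPDE.curl w x‖ ^ 2) ^ (3 / 4 : ℝ) * (∫ x,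
      Literature.Analysis.FluidPDE.frobeniusNormSq (fderiv ℝ (Literature.Analysis.FluidPDE.curl w) x)) ^ (3 / 4 : ℝ)) → c ≤ c') →
      ∀ K δ : ℝ, 0 < K → 0 < δ → ∀ v : ℕ → EuclideanSpace ℝ (Fin 3) → EuclideanSpace ℝ (Fin 3),
      (∀ n, (ContDiff ℝ (⊤ : ℕ∞) (v n) ∧
      Literature.Analysis.FluidPDE.VectorCalculus.IsDivFree (v n) ∧ (∫⁻ x, ‖iteratedFDeriv ℝ 0 (v n) x‖ₑ ^ 2 < ⊤) ∧
      (∫⁻ x, ‖iteratedFDeriv ℝ 1 (v n) x‖ₑ ^ 2 < ⊤) ∧ (∫⁻ x, ‖iteratedFDeriv ℝ 2 (v n) x‖ₑ ^ 2 < ⊤))) →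
      (∀ n, (∫ x, ‖Literature.Analysis.FluidPDE.curl (v n) x‖ ^ 2) = 1) →
      (∀ n, (∫ x, Literature.Analysis.FluidPDE.frobeniusNormSq (fderiv ℝ (Literature.Analysis.FluidPDE.curl (v n)) x)) = 1) →
      Tendsto (fun n => ∫ x, ⟪Literature.Analysis.FluidPDE.curl (v n) x, fderiv ℝ (v n) x
        (Literature.Analysis.FluidPDE.curl (v n) x)⟫_ℝ) atTop (𝓝 c) →
      (∀ᶠ n in atTop, δ ≤ ∫ x in Metric.ball (0 : EuclideanSpace ℝ (Fin 3)) K, ‖Literature.Analysis.FluidPDE.curl (v n) x‖ ^ 2) →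
      ∀ (φ₀ : ℕ → ℕ) (M : Fin 3 → EuclideanSpace ℝ (Fin 3) → EuclideanSpace ℝ (Fin 3)), StrictMono φ₀ →
      (∀ j, MemLp (M j) 2 volume) →
      (∀ (j : Fin 3) (ψ : EuclideanSpace ℝ (Fin 3) → EuclideanSpace ℝ (Fin 3)), MemLp ψ 2 volume →
        Tendsto (fun k => ∫ x, ⟪fderiv ℝ (v (φ₀ k)) x (EuclideanSpace.basisFun (Fin 3) ℝ j), ψ x⟫_ℝ) atTop
          (𝓝 (∫ x, ⟪M j x, ψ x⟫_ℝ))) →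
      ∃ w : EuclideanSpace ℝ (Fin 3) → EuclideanSpace ℝ (Fin 3), (ContDiff ℝ (⊤ : ℕ∞) w ∧
      Literature.Analysis.FluidPDE.VectorCalculus.IsDivFree w ∧ (∫⁻ x, ‖iteratedFDeriv ℝ 0 w x‖ₑ ^ 2 < ⊤) ∧
      (∫⁻ x, ‖iteratedFDeriv ℝ 1 w x‖ₑ ^ 2 < ⊤) ∧ (∫⁻ x, ‖iteratedFDeriv ℝ 2 w x‖ₑ ^ 2 < ⊤)) ∧
        (∀ j : Fin 3, (fun x => fderiv ℝ w x (EuclideanSpace.basisFun (Fin 3) ℝ j)) =ᵐ[volume] M j)) :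
    ∀ c : ℝ, (0 < c ∧ (∀ v : EuclideanSpace ℝ (Fin 3) → EuclideanSpace ℝ (Fin 3), (ContDiff ℝ (⊤ : ℕ∞) v ∧
      Literature.Analysis.FluidPDE.VectorCalculus.IsDivFree v ∧ (∫⁻ x, ‖iteratedFDeriv ℝ 0 v x‖ₑ ^ 2 < ⊤) ∧
      (∫⁻ x, ‖iteratedFDeriv ℝ 1 v x‖ₑ ^ 2 < ⊤) ∧ (∫⁻ x, ‖iteratedFDeriv ℝ 2 v x‖ₑ ^ 2 < ⊤)) → (∫ x,
      ⟪Literature.Analysis.FluidPDE.curl v x, fderiv ℝ v x (Literature.Analysis.FluidPDE.curl v x)⟫_ℝ) ≤ c *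
      (∫ x, ‖Literature.Analysis.FluidPDE.curl v x‖ ^ 2) ^ (3 / 4 : ℝ) * (∫ x,
      Literature.Analysis.FluidPDE.frobeniusNormSq (fderiv ℝ (Literature.Analysis.FluidPDE.curl v) x)) ^ (3 / 4 : ℝ)) ∧ ∀ c' : ℝ, (∀ w : EuclideanSpace ℝ (Fin 3) → EuclideanSpace ℝ (Fin 3), (ContDiff ℝ (⊤ : ℕ∞) w ∧
      Literature.Analysis.FluidPDE.VectorCalculus.IsDivFree w ∧ (∫⁻ x, ‖iteratedFDeriv ℝ 0 w x‖ₑ ^ 2 < ⊤) ∧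
      (∫⁻ x, ‖iteratedFDeriv ℝ 1 w x‖ₑ ^ 2 < ⊤) ∧ (∫⁻ x, ‖iteratedFDeriv ℝ 2 w x‖ₑ ^ 2 < ⊤)) → (∫ x,
      ⟪Literature.Analysis.FluidPDE.curl w x, fderiv ℝ w x (Literature.Analysis.FluidPDE.curl w x)⟫_ℝ) ≤ c' *
      (∫ x, ‖Literature.Analysis.FluidPDE.curl w x‖ ^ 2) ^ (3 / 4 : ℝ) * (∫ x,
      Literature.Analysis.FluidPDE.frobeniusNormSq (fderiv ℝ (Literature.Analysis.FluidPDE.curl w) x)) ^ (3 / 4 : ℝ)) → c ≤ c') →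
      ∀ K δ : ℝ, 0 < K → 0 < δ → ∀ v : ℕ → EuclideanSpace ℝ (Fin 3) → EuclideanSpace ℝ (Fin 3),
      (∀ n, (ContDiff ℝ (⊤ : ℕ∞) (v n) ∧
      Literature.Analysis.FluidPDE.VectorCalculus.IsDivFree (v n) ∧ (∫⁻ x, ‖iteratedFDeriv ℝ 0 (v n) x‖ₑ ^ 2 < ⊤) ∧
      (∫⁻ x, ‖iteratedFDeriv ℝ 1 (v n) x‖ₑ ^ 2 < ⊤) ∧ (∫⁻ x, ‖iteratedFDeriv ℝ 2 (v n) x‖ₑ ^ 2 < ⊤))) →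
      (∀ n, (∫ x, ‖Literature.Analysis.FluidPDE.curl (v n) x‖ ^ 2) = 1) →
      (∀ n, (∫ x, Literature.Analysis.FluidPDE.frobeniusNormSq (fderiv ℝ (Literature.Analysis.FluidPDE.curl (v n)) x)) = 1) →
      Tendsto (fun n => ∫ x, ⟪Literature.Analysis.FluidPDE.curl (v n) x, fderiv ℝ (v n) x
        (Literature.Analysis.FluidPDE.curl (v n) x)⟫_ℝ) atTop (𝓝 c) →
      (∀ᶠ n in atTop, δ ≤ ∫ x in Metric.ball (0 : EuclideanSpace ℝ (Fin 3)) K, ‖Literature.Analysis.FluidPDE.curl (v n) x‖ ^ 2) →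
      ∀ (φ₀ : ℕ → ℕ) (M : Fin 3 → EuclideanSpace ℝ (Fin 3) → EuclideanSpace ℝ (Fin 3)), StrictMono φ₀ →
      (∀ j, MemLp (M j) 2 volume) →
      (∀ (j : Fin 3) (ψ : EuclideanSpace ℝ (Fin 3) → EuclideanSpace ℝ (Fin 3)), MemLp ψ 2 volume →
        Tendsto (fun k => ∫ x, ⟪fderiv ℝ (v (φ₀ k)) x (EuclideanSpace.basisFun (Fin 3) ℝ j), ψ x⟫_ℝ) atTop
          (𝓝 (∫ x, ⟪M j x, ψ x⟫_ℝ))) →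
      ∀ w₀ : EuclideanSpace ℝ (Fin 3) → EuclideanSpace ℝ (Fin 3), AEStronglyMeasurable w₀ volume →
        MemLp (fun x => ((1 : ℝ) + ‖x‖) ^ (-(3 / 2 : ℝ)) • w₀ x) 2 volume →
        (∀ (j : Fin 3) (ψ : EuclideanSpace ℝ (Fin 3) → EuclideanSpace ℝ (Fin 3)), ContDiff ℝ 1 ψ → HasCompactSupport ψ →
          ∫ x, ⟪w₀ x, fderiv ℝ ψ x (EuclideanSpace.basisFun (Fin 3) ℝ j)⟫_ℝ = -∫ x, ⟪M j x, ψ x⟫_ℝ) →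
        ∃ w : EuclideanSpace ℝ (Fin 3) → EuclideanSpace ℝ (Fin 3), ContDiff ℝ (⊤ : ℕ∞) w ∧
          (∫⁻ x, ‖iteratedFDeriv ℝ 0 w x‖ₑ ^ 2 < ⊤) ∧ (∫⁻ x, ‖iteratedFDeriv ℝ 1 w x‖ₑ ^ 2 < ⊤) ∧
          (∫⁻ x, ‖iteratedFDeriv ℝ 2 w x‖ₑ ^ 2 < ⊤) ∧ w =ᵐ[volume] w₀ := by
  intro c hsharp K δ hK hδ v hAdm hZ1 hP1 hS hcen φ₀ M hφ₀ hM hconv w₀ _ hw₀2 hprof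
  obtain ⟨w, hw, hMw⟩ := HI c hsharp K δ hK hδ v hAdm hZ1 hP1 hS hcen φ₀ M hφ₀ hM hconv
  obtain ⟨hw2, hprofw⟩ := weakProfile_of_admissible hw hMw
  exact ⟨w, hw.1, hw.2.2.1, hw.2.2.2.1, hw.2.2.2.2, weakProfile_unique hw2 hw₀2 hprofw hprof⟩

end SeqCore

end NearSaturationNearMaximiser

end Summit.NavierStokesRegularity.NavierStokesRegularity.Theorems

end
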